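import Literature.Geometry.Riemannian.PerelmanEntropyCutoff
import HarnessLib

/-!
# Truncation calculus for the Bakry–Émery logarithmic Sobolev inequality on a complete manifold

Pointwise lemmas for the density step of the named fact `bakryEmery_logSobolev_complete`
(`BakryEmeryLogSobolev.lean`; Bakry–Gentil–Ledoux 2014, Def. 5.1.1, Rem. 5.1.2 and Prop. 5.7.1: a
logarithmic Sobolev inequality is established first for the class `A₀^{const+}` of smooth functions that
are a positive constant plus a compactly supported smooth function, "and then extended to more general
functions taking limits"), carried out in `BakryEmeryLogSobolevReduction.lean` with the truncations
`g_N = χ_N e^{φ/2} + (1 − χ_N) s_N` of a density `e^{φ}` by Gaffney cut-offs `χ_N`: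

* `innerDual_self_nonneg_of_isRiemannian`, `innerDual_add_add_le` — `g⁻¹(α, α) ≥ 0` and the
  Peter–Paul bound `g⁻¹(α + β, α + β) ≤ (1 + η) g⁻¹(α, α) + (1 + η⁻¹) g⁻¹(β, β)` for a Riemannian `g`;
* `gradSq_cutoff_interpolate_le` — `|∇(χ(F − s) + s)|² ≤ (1 + η) χ²|∇F|² + (1 + η⁻¹)(F − s)²|∇χ|²`;
* `four_mul_gradSq_exp_half`, `gradSq_two_mul_log_mul_sq` — `4|∇e^{φ/2}|² = |∇φ|² e^{φ}` and
  `|∇(2 log F)|² F² = 4|∇F|²`;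
* `cutoff_interpolate_pos`, `abs_sq_mul_log_sq_le` — positivity of the truncation and the domination
  `|t² log t²| ≤ 1 + |G² log G²|` of its entropy integrand (`t = χ(G − s) + s`, `0 < s ≤ 1`).

Theorems only; no definitions, no named facts.

## References

* [BakryGentilLedoux2014] D. Bakry, I. Gentil, M. Ledoux, *Analysis and Geometry of Markov Diffusion
  Operators*, Springer 2014, Def. 5.1.1 and Rem. 5.1.2 (pp. 236–237), Prop. 5.7.1 (p. 268).
-/

noncomputable section

open Bundle Set Function Filter Manifold
open scoped Manifold ContDiff Topology

namespace Literature.Geometry.Riemannian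

open Lorentzian Lorentzian.PseudoRiemannianMetric

/-! ### Pointwise lemmas -/

section Pointwise

variable {n : ℕ} {M : Type*} [TopologicalSpace M] [ChartedSpace (EuclideanSpace ℝ (Fin n)) M]
  [IsManifold (𝓡 n) ∞ M]
  {g : PseudoRiemannianMetric (𝓡 n) ∞ (EuclideanSpace ℝ (Fin n)) (TangentSpace (𝓡 n) : M → Type _)}

/-- `g⁻¹(α, α) ≥ 0` for a Riemannian `g` and every covector `α`. [folklore] -/
theorem innerDual_self_nonneg_of_isRiemannian (hg : g.IsRiemannian) (x : M)
    (α : Module.Dual ℝ (TangentSpace (𝓡 n) x)) : 0 ≤ g.innerDual x α α := by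
  rw [innerDual_eq_val_sharp_sharp]
  by_cases h : g.sharp x α = 0
  · rw [h]; simp
  · exact (hg x _ h).le

/-- **Peter–Paul for the inverse metric** of a Riemannian `g`:
`g⁻¹(α + β, α + β) ≤ (1 + η) g⁻¹(α, α) + (1 + η⁻¹) g⁻¹(β, β)` for `η > 0`
(from `g⁻¹(ηα − β, ηα − β) ≥ 0`). [folklore] -/
theorem innerDual_add_add_le (hg : g.IsRiemannian) (x : M)
    (α β : Module.Dual ℝ (TangentSpace (𝓡 n) x)) {η : ℝ} (hη : 0 < η) :
    g.innerDual x (α + β) (α + β) ≤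
      (1 + η) * g.innerDual x α α + (1 + η⁻¹) * g.innerDual x β β := by
  have h0 : 0 ≤ g.innerDual x (η • α - β) (η • α - β) :=
    innerDual_self_nonneg_of_isRiemannian hg x _
  have hα0 : 0 ≤ g.innerDual x α α := innerDual_self_nonneg_of_isRiemannian hg x _
  have hβ0 : 0 ≤ g.innerDual x β β := innerDual_self_nonneg_of_isRiemannian hg x _
  have hβα : g.innerDual x β α = g.innerDual x α β := g.innerDual_comm x β α
  have e1 : g.innerDual x (α + β) (α + β) =
      g.innerDual x α α + 2 * g.innerDual x α β + g.innerDual x β β := by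
    simp only [PseudoRiemannianMetric.innerDual, map_add, LinearMap.add_apply] at hβα ⊢
    rw [hβα]; ring
  have e2 : g.innerDual x (η • α - β) (η • α - β) =
      η ^ 2 * g.innerDual x α α - 2 * η * g.innerDual x α β + g.innerDual x β β := by
    simp only [PseudoRiemannianMetric.innerDual, map_sub, map_smul, LinearMap.sub_apply,
      LinearMap.smul_apply, smul_eq_mul] at hβα ⊢
    rw [hβα]; ring
  rw [e2] at h0
  have key : 2 * g.innerDual x α β ≤ η * g.innerDual x α α + η⁻¹ * g.innerDual x β β := by
    have h1 : η * (2 * g.innerDual x α β) ≤ η * (η * g.innerDual x α α + η⁻¹ * g.innerDual x β β) := by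
      have : η * (η * g.innerDual x α α + η⁻¹ * g.innerDual x β β) =
          η ^ 2 * g.innerDual x α α + g.innerDual x β β := by
        field_simp
      rw [this]; nlinarith [h0]
    exact le_of_mul_le_mul_left h1 hη
  rw [e1]; nlinarith [key]

/-- **The gradient of the truncation `χ (F − s) + s`**: at a point where `χ` and `F` are
differentiable, `|∇(χ(F − s) + s)|² ≤ (1 + η) χ² |∇F|² + (1 + η⁻¹)(F − s)² |∇χ|²` for every `η > 0`
(`d(χ(F − s) + s) = χ dF + (F − s) dχ` and Peter–Paul). [folklore] -/
theorem gradSq_cutoff_interpolate_le (hg : g.IsRiemannian) {χ F : M → ℝ} {x : M}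
    (hχ : MDifferentiableAt (𝓡 n) 𝓘(ℝ, ℝ) χ x) (hF : MDifferentiableAt (𝓡 n) 𝓘(ℝ, ℝ) F x)
    (s : ℝ) {η : ℝ} (hη : 0 < η) :
    g.gradSq (fun y ↦ χ y * (F y - s) + s) x ≤
      (1 + η) * (χ x ^ 2 * g.gradSq F x) + (1 + η⁻¹) * ((F x - s) ^ 2 * g.gradSq χ x) := by
  have hFs : MDifferentiableAt (𝓡 n) 𝓘(ℝ, ℝ) (fun y ↦ F y - s) x :=
    hF.sub mdifferentiableAt_const
  have hprod : MDifferentiableAt (𝓡 n) 𝓘(ℝ, ℝ) (fun y ↦ χ y * (F y - s)) x := hχ.mul hFs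
  -- the differential
  have hd : (mvfderiv (𝓡 n) (fun y ↦ χ y * (F y - s) + s) x : TangentSpace (𝓡 n) x →ₗ[ℝ] ℝ) =
      χ x • (mvfderiv (𝓡 n) F x : TangentSpace (𝓡 n) x →ₗ[ℝ] ℝ) +
        (F x - s) • (mvfderiv (𝓡 n) χ x : TangentSpace (𝓡 n) x →ₗ[ℝ] ℝ) := by
    have h1 : mvfderiv (𝓡 n) (fun y ↦ χ y * (F y - s) + s) x =
        mvfderiv (𝓡 n) (fun y ↦ χ y * (F y - s)) x := by
      rw [show (fun y ↦ χ y * (F y - s) + s) = (fun y ↦ χ y * (F y - s)) + fun _ ↦ s from rfl,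
        mvfderiv_add hprod mdifferentiableAt_const, mvfderiv_const, add_zero]
    have h2 : mvfderiv (𝓡 n) (fun y ↦ χ y * (F y - s)) x =
        χ x • mvfderiv (𝓡 n) (fun y ↦ F y - s) x + (F x - s) • mvfderiv (𝓡 n) χ x := by
      rw [show (fun y ↦ χ y * (F y - s)) = χ * fun y ↦ F y - s from rfl, mvfderiv_mul hχ hFs]
    have h3 : mvfderiv (𝓡 n) (fun y ↦ F y - s) x = mvfderiv (𝓡 n) F x := by
      rw [show (fun y ↦ F y - s) = F - fun _ ↦ s from rfl, mvfderiv_sub hF mdifferentiableAt_const,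
        mvfderiv_const, sub_zero]
    rw [h1, h2, h3]
    simp
  set α : Module.Dual ℝ (TangentSpace (𝓡 n) x) := (mvfderiv (𝓡 n) F x : TangentSpace (𝓡 n) x →ₗ[ℝ] ℝ)
  set β : Module.Dual ℝ (TangentSpace (𝓡 n) x) := (mvfderiv (𝓡 n) χ x : TangentSpace (𝓡 n) x →ₗ[ℝ] ℝ)
  have hPP := innerDual_add_add_le hg x (χ x • α) ((F x - s) • β) hη
  have hαα : g.innerDual x (χ x • α) (χ x • α) = χ x ^ 2 * g.gradSq F x := by
    rw [g.innerDual_smul_smul, PseudoRiemannianMetric.gradSq]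
  have hββ : g.innerDual x ((F x - s) • β) ((F x - s) • β) = (F x - s) ^ 2 * g.gradSq χ x := by
    rw [g.innerDual_smul_smul, PseudoRiemannianMetric.gradSq]
  rw [PseudoRiemannianMetric.gradSq, hd]
  rw [hαα, hββ] at hPP
  exact hPP

/-- `4 |∇e^{φ/2}|² = |∇φ|² e^{φ}` at a point of differentiability. [folklore] -/
theorem four_mul_gradSq_exp_half {φ : M → ℝ} {x : M} (hφ : MDifferentiableAt (𝓡 n) 𝓘(ℝ, ℝ) φ x) :
    4 * g.gradSq (fun y ↦ Real.exp (φ y / 2)) x = g.gradSq φ x * Real.exp (φ x) := by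
  have hh : HasDerivAt (fun t : ℝ ↦ Real.exp (t / 2)) (Real.exp (φ x / 2) * (1 / 2)) (φ x) :=
    ((hasDerivAt_id (φ x)).div_const 2).exp
  have key := g.gradSq_real_comp (h := fun t : ℝ ↦ Real.exp (t / 2)) hh hφ
  rw [show (fun y ↦ Real.exp (φ y / 2)) = (fun t : ℝ ↦ Real.exp (t / 2)) ∘ φ from rfl, key]
  have hsq : Real.exp (φ x / 2) ^ 2 = Real.exp (φ x) := by
    rw [sq, ← Real.exp_add, add_halves]
  calc 4 * ((Real.exp (φ x / 2) * (1 / 2)) ^ 2 * g.gradSq φ x)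
      = Real.exp (φ x / 2) ^ 2 * g.gradSq φ x := by ring
    _ = g.gradSq φ x * Real.exp (φ x) := by rw [hsq, mul_comm]

/-- `|∇(2 log F)|² F² = 4 |∇F|²` at a point where `F > 0` is differentiable. [folklore] -/
theorem gradSq_two_mul_log_mul_sq {F : M → ℝ} {x : M} (hF : MDifferentiableAt (𝓡 n) 𝓘(ℝ, ℝ) F x)
    (hFx : 0 < F x) :
    g.gradSq (fun y ↦ 2 * Real.log (F y)) x * F x ^ 2 = 4 * g.gradSq F x := by
  have hh : HasDerivAt (fun t : ℝ ↦ 2 * Real.log t) (2 * (F x)⁻¹) (F x) :=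
    (Real.hasDerivAt_log hFx.ne').const_mul 2
  have key := g.gradSq_real_comp (h := fun t : ℝ ↦ 2 * Real.log t) hh hF
  rw [show (fun y ↦ 2 * Real.log (F y)) = (fun t : ℝ ↦ 2 * Real.log t) ∘ F from rfl, key]
  field_simp
  ring

end Pointwise

/-! ### Two real inequalities -/

/-- The truncation `χ(G − s) + s = χG + (1 − χ)s` of a positive `G` at a positive level `s`,
`χ ∈ [0, 1]`, is positive. [folklore] -/
theorem cutoff_interpolate_pos {χ G s : ℝ} (h0 : 0 ≤ χ) (h1 : χ ≤ 1) (hG : 0 < G) (hs : 0 < s) :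
    0 < χ * (G - s) + s := by
  rcases le_total s G with hsG | hGs
  · nlinarith
  · nlinarith

/-- **The entropy integrand of a truncation is dominated**: for `t = χ(G − s) + s` with `χ ∈ [0, 1]`,
`G > 0`, `0 < s ≤ 1`: `|t² log t²| ≤ 1 + |G² log G²|` (`|u log u| ≤ 1` on `(0, 1]`; for `t > 1`,
`t ≤ G` and `u ↦ u log u` is increasing on `[1, ∞)`). [folklore] -/
theorem abs_sq_mul_log_sq_le {χ G s : ℝ} (h0 : 0 ≤ χ) (h1 : χ ≤ 1) (hG : 0 < G) (hs : 0 < s)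
    (hs1 : s ≤ 1) :
    |(χ * (G - s) + s) ^ 2 * Real.log ((χ * (G - s) + s) ^ 2)| ≤
      1 + |G ^ 2 * Real.log (G ^ 2)| := by
  set t := χ * (G - s) + s with ht
  have htpos : 0 < t := cutoff_interpolate_pos h0 h1 hG hs
  have ht2 : 0 < t ^ 2 := by positivity
  rcases le_or_gt t 1 with hle | hgt
  · -- `t² ≤ 1`: `|t² log t²| < 1`
    have h2 : t ^ 2 ≤ 1 := by nlinarith
    have := Real.abs_log_mul_self_lt (t ^ 2) ht2 h2
    rw [mul_comm] at this
    linarith [abs_nonneg (G ^ 2 * Real.log (G ^ 2))]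
  · -- `t > 1`: then `t ≤ G` (as `s ≤ 1`) and monotonicity on `[1, ∞)`
    have htG : t ≤ G := by
      rcases le_total s G with hsG | hGs
      · nlinarith
      · nlinarith
    have h1t : 1 ≤ t ^ 2 := by nlinarith
    have htG2 : t ^ 2 ≤ G ^ 2 := by nlinarith
    have hlogt : 0 ≤ Real.log (t ^ 2) := Real.log_nonneg h1t
    have hlogG : Real.log (t ^ 2) ≤ Real.log (G ^ 2) := Real.log_le_log ht2 htG2
    have hmono : t ^ 2 * Real.log (t ^ 2) ≤ G ^ 2 * Real.log (G ^ 2) :=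
      mul_le_mul htG2 hlogG hlogt (by positivity)
    rw [abs_of_nonneg (mul_nonneg ht2.le hlogt)]
    linarith [le_abs_self (G ^ 2 * Real.log (G ^ 2))]


end Literature.Geometry.Riemannian

end
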